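import Summits.CriticalPhenomena.PercolationContinuityZ3.Theorems.PercNearOneGluingNoHeavyQuantSGCLightPairRates
import HarnessLib

/-!
# QUANT lane R8, T-DEC, cell L2 (`LawDec.SGCLightPair`), part 1b: the PER-COPY pieces of the two-copy partial flow

builds on p205010 (kernel theorem, internal audit signed; external expert review pending)

Support file (`--supports stmt-CriticalPhenomena-4575`), QUANT lane seat prim-quant-arm-2 (gen 37), rung R8 of
`run/shared/lean/prim/quant/LADDER.md`.  Theorems only, standard axioms, no sorries.  Memo
`run/shared/lean/prim/quant/prim-quant-arm-2-g37/L2-TRANSPORT-G37.md` §5 (exact census of the construction: 434 298 / 434 298 layers).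

THE CELL `SGCLightPair` (typer g30): `μ₁` admissible, `{lo,hi;γ}` a LIGHT admissible top-affordable pair (so `2·lo ≥ τ₂ = qT₂`,
`lightPair_two_lo_ge`); the gated product `L = gate_q(μ₁ ∗ {lo,hi;γ}) = (1−q)δ₀ + (1−γ)qμ₁(·−lo) + γqμ₁(·−hi)` is DEC at every layer at the
target `τ₁ + τ₂`.  THE CONSTRUCTION is typer g26's one-layer gated-shift construction (`…QuantGatedShiftPartial/OneLayer`) run from TWO source
layers `j − lo`, `j − hi` of `ν₁ = gate_q μ₁` with the slots and the giant room POOLED (parts 2, 2b); this file provides, for ONE copy (shift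
`s ≥ 1`, weight `c ≥ 0`, increment `Δ ≤ 2s`, source flow `f` of `ν₁` at `(y, S, J)`), the shifted mid pairs `mid`, the slots `slot` (images of
the mids used by the gate zero of `ν₁`), the giant-bound masses `R` of the copy's nonzero lows, and their bookkeeping.  Rates: part 1a
(`…SGCLightPairRates`: `usage_copy_le`, `usage_slot_le_shift`, `sum_ite_shift_range`).

* **`lightPair_copy`** — the per-copy pieces (fifteen conjuncts).
[this work]; rates / one-copy construction: typer g22/g25/g26.  Rows served [cite: KozmaNitzan2024, Conjecture 3 (p. 15)]; [cite: Grimmett1999, §1.3 p. 10].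
-/

noncomputable section

namespace Summit.CriticalPhenomena.PercolationContinuityZ3.Theorems

namespace Quant

open Finset

namespace LawDec

/-! ### The per-copy pieces -/

/-- **THE PER-COPY PIECES OF THE TWO-COPY PARTIAL FLOW** (file header): for one copy — shift `s ≥ 1`, weight `c ≥ 0`, increment
`Δ ≤ 2s`, source flow `f` of `ν₁ = gate μ₁ q` at `(y, S, J, M₁)`, product layer `j = J + s < M`, `M₁ + s ≤ M` — the pieces `mid`, `slot`, `R`
(a NONZERO COPY LOW is `t` with `s+1 ≤ t ≤ j`, `2t < S + Δ`) with: nonnegativity (1–3); support / vanishing of `mid` (4–5) and `slot` (6–7);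
the COLUMN bound (8) and its cap by `c·ν₁(k−s)` (9); the ROW identity (10); `R` at `t = s` and off the copy lows (11); the bound on `Σ R`
(12); the zero-row split (13); the giant certification (14); and the KEY inequality `y/(1−y)·(c(1−q) + Σ_t R t − Σ_k slot k) ≤
c·Σ_{J<h≤M₁} ν₁ h` (15). [this work] -/
theorem lightPair_copy (y S Δ q c : ℝ) (J s j M₁ M : ℕ) (μ₁ : ℕ → ℝ) (f : ℕ → ℕ → ℝ) (hy0 : 0 < y) (hy1 : y < 1)
    (hq0 : 0 < q) (hc0 : 0 ≤ c) (hS : 0 < S) (hΔs : Δ ≤ 2 * (s : ℝ)) (hs : 1 ≤ s) (hj : J + s = j)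
    (hM : M₁ + s ≤ M) (hJM : j < M) (hμ0 : ∀ h, 0 ≤ μ₁ h) (hf : IsFlowAtT y S J M₁ (gate μ₁ q) f) :
    ∃ (mid : ℕ → ℕ → ℝ) (slot : ℕ → ℝ) (R : ℕ → ℝ),
      (∀ t k, 0 ≤ mid t k) ∧ (∀ k, 0 ≤ slot k) ∧ (∀ t, 0 ≤ R t) ∧
      (∀ t k, 0 < mid t k → (s + 1 ≤ t ∧ t ≤ j ∧ 2 * (t : ℝ) < S + Δ) ∧ s + 1 ≤ k ∧ k ≤ j ∧ k ≤ M₁ + s ∧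
        S + Δ < (t : ℝ) + k) ∧
      (∀ t k, ¬ ((s + 1 ≤ t ∧ t ≤ j ∧ 2 * (t : ℝ) < S + Δ) ∧ s + 1 ≤ k ∧ k ≤ j) → mid t k = 0) ∧
      (∀ k, 0 < slot k → s + 1 ≤ k ∧ k ≤ j ∧ k ≤ M₁ + s ∧ S < (((k - s : ℕ)) : ℝ)) ∧
      (∀ k, ¬ (s + 1 ≤ k ∧ k ≤ j) → slot k = 0) ∧
      (∀ k, s + 1 ≤ k → k ≤ j →
        ∑ t ∈ Finset.range (j + 1), usage y (S + Δ) j t k * mid t k + usage y S J 0 (k - s) * slot k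
          ≤ c * ∑ l ∈ Finset.range (J + 1), usage y S J l (k - s) * f l (k - s)) ∧
      (∀ k, s + 1 ≤ k → k ≤ j →
        c * ∑ l ∈ Finset.range (J + 1), usage y S J l (k - s) * f l (k - s) ≤ c * gate μ₁ q (k - s)) ∧
      (∀ t, (s + 1 ≤ t ∧ t ≤ j ∧ 2 * (t : ℝ) < S + Δ) →
        ∑ k ∈ Finset.range (M + 1), mid t k + R t = c * (q * μ₁ (t - s))) ∧
      ((2 * (s : ℝ) < S + Δ → R s = c * (q * μ₁ 0)) ∧
        (∀ t, ¬ (s + 1 ≤ t ∧ t ≤ j ∧ 2 * (t : ℝ) < S + Δ) → ¬ (t = s ∧ 2 * (s : ℝ) < S + Δ) → R t = 0)) ∧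
      (∑ t ∈ Finset.range (j + 1), R t
        ≤ c * (q * μ₁ 0) + c * ∑ l ∈ Finset.range J, ∑ h ∈ Finset.Ico (J + 1) (M₁ + 1), f (l + 1) h) ∧
      (∑ k ∈ Finset.range (M + 1), slot k = c * gate μ₁ q 0 - c * ∑ h ∈ Finset.Ico (J + 1) (M₁ + 1), f 0 h) ∧
      (y / (1 - y) * (c * ∑ l ∈ Finset.range (J + 1), ∑ h ∈ Finset.Ico (J + 1) (M₁ + 1), f l h)
        ≤ c * ∑ h ∈ Finset.Ico (J + 1) (M₁ + 1), gate μ₁ q h) ∧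
      (y / (1 - y) * (c * (1 - q) + ∑ t ∈ Finset.range (j + 1), R t - ∑ k ∈ Finset.range (M + 1), slot k)
        ≤ c * ∑ h ∈ Finset.Ico (J + 1) (M₁ + 1), gate μ₁ q h) := by
  subst hj
  classical
  have hterm := hf.term_nonneg hy0 hy1
  obtain ⟨hf0, hsupp, hrow, hcap⟩ := hf
  set S' : ℝ := S + Δ with hS'
  set ν : ℕ → ℝ := gate μ₁ q with hν
  set uy : ℝ := y / (1 - y) with huy
  /- ### scalars, values of `ν`, facts about `f` -/
  have huy0 : 0 < uy := div_pos hy0 (by linarith)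
  have hνval : ∀ h, ν h = q * μ₁ h + (1 - q) * (if h = 0 then (1 : ℝ) else 0) := fun h => by rw [hν, gate_apply]
  have hν0 : ν 0 = 1 - q + q * μ₁ 0 := by rw [hνval, if_pos rfl]; ring
  have hνpos : ∀ h, 1 ≤ h → ν h = q * μ₁ h := fun h hh => by rw [hνval, if_neg (by omega)]; ring
  have hlh : ∀ l h, 0 < f l h → l < h := by
    intro l h hp
    obtain ⟨_, hlow, _, hadm⟩ := hsupp l h hp
    rcases hadm with h1 | h2
    · omega
    · by_contra hcn
      linarith [(Nat.cast_nonneg l : (0 : ℝ) ≤ l), (show (h : ℝ) ≤ l by exact_mod_cast not_lt.1 hcn)]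
  have hfM : ∀ l h, M₁ < h → f l h = 0 := by
    intro l h hh
    by_contra hne
    have hp : 0 < f l h := lt_of_le_of_ne (hf0 l h) (Ne.symm hne)
    obtain ⟨_, _, hhM, _⟩ := hsupp l h hp
    omega
  have hrow0 : ∑ h ∈ Finset.range (M₁ + 1), f 0 h = ν 0 := hrow 0 (Nat.zero_le J) (by simpa using hS)
  -- a nonzero copy low `t` has the `ν`-low `t - s`
  have hPL : ∀ t, (s + 1 ≤ t ∧ t ≤ J + s ∧ 2 * (t : ℝ) < S') → 1 ≤ t - s ∧ t - s ≤ J ∧ 2 * (((t - s : ℕ)) : ℝ) < S := by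
    intro t ht
    refine ⟨by omega, by omega, ?_⟩
    have e : (((t - s : ℕ)) : ℝ) = (t : ℝ) - s := by push_cast [Nat.cast_sub (show s ≤ t by omega)]; ring
    rw [e, hS'] at *
    linarith [ht.2.2]
  /- ### the pieces -/
  set mid : ℕ → ℕ → ℝ := fun t k =>
    if (s + 1 ≤ t ∧ t ≤ J + s ∧ 2 * (t : ℝ) < S') ∧ s + 1 ≤ k ∧ k ≤ J + s then c * f (t - s) (k - s) else 0 with hmid
  set slot : ℕ → ℝ := fun k => if s + 1 ≤ k ∧ k ≤ J + s then c * f 0 (k - s) else 0 with hslot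
  set R : ℕ → ℝ := fun t =>
    if (s + 1 ≤ t ∧ t ≤ J + s ∧ 2 * (t : ℝ) < S') then c * (q * μ₁ (t - s)) - ∑ k ∈ Finset.range (M + 1), mid t k
    else if (t = s ∧ 2 * (s : ℝ) < S') then c * (q * μ₁ 0) else 0 with hR
  have hmid0 : ∀ t k, 0 ≤ mid t k := fun t k => by simp only [hmid]; split_ifs; exacts [mul_nonneg hc0 (hf0 _ _), le_rfl]
  have hslot0 : ∀ k, 0 ≤ slot k := fun k => by simp only [hslot]; split_ifs; exacts [mul_nonneg hc0 (hf0 _ _), le_rfl]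
  have hmidz : ∀ t k, ¬ ((s + 1 ≤ t ∧ t ≤ J + s ∧ 2 * (t : ℝ) < S') ∧ s + 1 ≤ k ∧ k ≤ J + s) → mid t k = 0 :=
    fun t k hn => by simp only [hmid]; rw [if_neg hn]
  have hslotz : ∀ k, ¬ (s + 1 ≤ k ∧ k ≤ J + s) → slot k = 0 := fun k hn => by simp only [hslot]; rw [if_neg hn]
  have hmidpos : ∀ t k, 0 < mid t k → ((s + 1 ≤ t ∧ t ≤ J + s ∧ 2 * (t : ℝ) < S') ∧ s + 1 ≤ k ∧ k ≤ J + s) ∧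
      0 < f (t - s) (k - s) := by
    intro t k hp
    simp only [hmid] at hp
    by_cases hcnd : (s + 1 ≤ t ∧ t ≤ J + s ∧ 2 * (t : ℝ) < S') ∧ s + 1 ≤ k ∧ k ≤ J + s
    · rw [if_pos hcnd] at hp
      refine ⟨hcnd, ?_⟩
      rcases (hf0 (t - s) (k - s)).eq_or_lt with hz | hpos
      · rw [← hz, mul_zero] at hp; exact absurd hp (lt_irrefl 0)
      · exact hpos
    · exact absurd (by rwa [if_neg hcnd] at hp) (lt_irrefl (0:ℝ))
  have hmidsupp : ∀ t k, 0 < mid t k → (s + 1 ≤ t ∧ t ≤ J + s ∧ 2 * (t : ℝ) < S') ∧ s + 1 ≤ k ∧ k ≤ J + s ∧ k ≤ M₁ + s ∧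
      S' < (t : ℝ) + k := by
    intro t k hp
    obtain ⟨⟨ht, hk1, hkJ⟩, hfp⟩ := hmidpos t k hp
    obtain ⟨_, _, hkM, hadm⟩ := hsupp _ _ hfp
    refine ⟨ht, hk1, hkJ, by omega, ?_⟩
    rcases hadm with h1 | h2
    · omega
    · have et : (((t - s : ℕ)) : ℝ) = (t : ℝ) - s := by push_cast [Nat.cast_sub (show s ≤ t by omega)]; ring
      have ek : (((k - s : ℕ)) : ℝ) = (k : ℝ) - s := by push_cast [Nat.cast_sub (show s ≤ k by omega)]; ring
      rw [et, ek] at h2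
      rw [hS']; linarith
  have hslotsupp : ∀ k, 0 < slot k → s + 1 ≤ k ∧ k ≤ J + s ∧ k ≤ M₁ + s ∧ S < (((k - s : ℕ)) : ℝ) := by
    intro k hp
    simp only [hslot] at hp
    by_cases hk : s + 1 ≤ k ∧ k ≤ J + s
    · rw [if_pos hk] at hp
      have hfp : 0 < f 0 (k - s) := (hf0 0 (k - s)).eq_or_lt.resolve_left (fun hz => by
        rw [← hz, mul_zero] at hp; exact absurd hp (lt_irrefl 0))
      obtain ⟨_, _, hkM, hadm⟩ := hsupp 0 (k - s) hfp
      have hSk : S < (((k - s : ℕ)) : ℝ) := by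
        rcases hadm with h1 | h2
        · omega
        · simpa using h2
      exact ⟨hk.1, hk.2, by omega, hSk⟩
    · rw [if_neg hk] at hp; exact absurd hp (lt_irrefl 0)
  /- ### row sums of the pieces (reindexing by the shift) -/
  have hmid_row : ∀ t, (s + 1 ≤ t ∧ t ≤ J + s ∧ 2 * (t : ℝ) < S') →
      ∑ k ∈ Finset.range (M + 1), mid t k = c * ∑ h ∈ Finset.range (M₁ + 1), (if h ≤ J then f (t - s) h else 0) := by
    intro t ht
    have e1 : ∀ k ∈ Finset.range (M + 1), mid t k
        = (if s ≤ k then (fun i => if 1 ≤ i ∧ i ≤ J then c * f (t - s) i else 0) (k - s) else 0) := by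
      intro k _
      simp only [hmid]
      by_cases hsk : s ≤ k
      · rw [if_pos hsk]
        by_cases hi : 1 ≤ k - s ∧ k - s ≤ J
        · rw [if_pos hi, if_pos ⟨ht, by omega, by omega⟩]
        · rw [if_neg hi, if_neg (fun hc => hi ⟨by omega, by omega⟩)]
      · rw [if_neg hsk, if_neg (fun hc => hsk (by omega))]
    rw [Finset.sum_congr rfl e1, sum_ite_shift_range (fun i => if 1 ≤ i ∧ i ≤ J then c * f (t - s) i else 0) s M (by omega),
      Finset.mul_sum]
    have e2 : ∑ h ∈ Finset.range (M₁ + 1), c * (if h ≤ J then f (t - s) h else 0)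
        = ∑ h ∈ Finset.range (M + 1 - s), c * (if h ≤ J then f (t - s) h else 0) := by
      refine Finset.sum_subset (Finset.range_mono (by omega)) ?_
      intro h hh hn
      rw [Finset.mem_range] at hh hn
      rw [hfM _ h (by omega)]; simp
    rw [e2]
    refine Finset.sum_congr rfl fun h hh => ?_
    rw [Finset.mem_range] at hh
    by_cases hJ : h ≤ J
    · by_cases h1 : 1 ≤ h
      · rw [if_pos ⟨h1, hJ⟩, if_pos hJ]
      · have h0 : h = 0 := by omega
        subst h0
        rw [if_neg (fun hc => absurd hc.1 (by omega)), if_pos hJ]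
        rcases (hf0 (t - s) 0).eq_or_lt with hz | hp
        · rw [← hz, mul_zero]
        · exact absurd (hlh _ 0 hp) (Nat.not_lt_zero _)
    · rw [if_neg (fun hc => hJ hc.2), if_neg hJ, mul_zero]
  have hLa : ∀ t, (s + 1 ≤ t ∧ t ≤ J + s ∧ 2 * (t : ℝ) < S') →
      q * μ₁ (t - s) = ∑ h ∈ Finset.range (M₁ + 1), f (t - s) h := by
    intro t ht
    obtain ⟨h1, hJ, hlow⟩ := hPL t ht
    rw [← hνpos (t - s) h1]
    exact (hrow (t - s) hJ hlow).symm
  have hRnz : ∀ t, (s + 1 ≤ t ∧ t ≤ J + s ∧ 2 * (t : ℝ) < S') →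
      R t = c * ∑ h ∈ Finset.range (M₁ + 1), (if J + 1 ≤ h then f (t - s) h else 0) := by
    intro t ht
    simp only [hR]
    rw [if_pos ht, hmid_row t ht, hLa t ht, Finset.mul_sum, Finset.mul_sum, Finset.mul_sum, ← Finset.sum_sub_distrib]
    refine Finset.sum_congr rfl fun h _ => ?_
    by_cases hh : h ≤ J
    · rw [if_pos hh, if_neg (by omega), mul_zero, sub_self]
    · rw [if_neg hh, if_pos (by omega), mul_zero, sub_zero]
  have hRs : 2 * (s : ℝ) < S' → R s = c * (q * μ₁ 0) := by
    intro hsl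
    simp only [hR]
    rw [if_neg (fun hc => absurd hc.1 (by omega))]
    simp [hsl]
  have hRz : ∀ t, ¬ (s + 1 ≤ t ∧ t ≤ J + s ∧ 2 * (t : ℝ) < S') → ¬ (t = s ∧ 2 * (s : ℝ) < S') → R t = 0 := by
    intro t h1 h2
    simp only [hR]; rw [if_neg h1, if_neg h2]
  have hR0 : ∀ t, 0 ≤ R t := by
    intro t
    by_cases ht : (s + 1 ≤ t ∧ t ≤ J + s ∧ 2 * (t : ℝ) < S')
    · rw [hRnz t ht]; exact mul_nonneg hc0 (Finset.sum_nonneg fun h _ => by split_ifs; exacts [hf0 _ _, le_rfl])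
    · by_cases h2 : (t = s ∧ 2 * (s : ℝ) < S')
      · obtain ⟨rfl, hsl⟩ := h2
        rw [hRs hsl]; exact mul_nonneg hc0 (mul_nonneg hq0.le (hμ0 0))
      · rw [hRz t ht h2]
  have hrowid : ∀ t, (s + 1 ≤ t ∧ t ≤ J + s ∧ 2 * (t : ℝ) < S') →
      ∑ k ∈ Finset.range (M + 1), mid t k + R t = c * (q * μ₁ (t - s)) := by
    intro t ht
    have : R t = c * (q * μ₁ (t - s)) - ∑ k ∈ Finset.range (M + 1), mid t k := by simp only [hR]; rw [if_pos ht]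
    rw [this]; ring
  /- ### the column bound -/
  have hcol : ∀ k, s + 1 ≤ k → k ≤ J + s →
      ∑ t ∈ Finset.range (J + s + 1), usage y S' (J + s) t k * mid t k + usage y S J 0 (k - s) * slot k
        ≤ c * ∑ l ∈ Finset.range (J + 1), usage y S J l (k - s) * f l (k - s) := by
    intro k hk1 hkJ
    obtain ⟨m, rfl⟩ : ∃ m, k = m + s := ⟨k - s, by omega⟩
    simp only [Nat.add_sub_cancel]
    -- the mid part: reindex `t = l + s`, compare termwise by `usage_copy_le`
    have hT1 : ∑ t ∈ Finset.range (J + s + 1), usage y S' (J + s) t (m + s) * mid t (m + s)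
        ≤ c * ∑ l ∈ Finset.range (J + 1), (if 1 ≤ l then usage y S J l m * f l m else 0) := by
      have e1 : ∀ t ∈ Finset.range (J + s + 1), usage y S' (J + s) t (m + s) * mid t (m + s)
          = (if s ≤ t then (fun l => usage y S' (J + s) (l + s) (m + s) * mid (l + s) (m + s)) (t - s) else 0) := by
        intro t _
        by_cases hst : s ≤ t
        · rw [if_pos hst]; simp only [Nat.sub_add_cancel hst]
        · rw [if_neg hst, hmidz t (m + s) (fun hc => hst (by omega)), mul_zero]
      rw [Finset.sum_congr rfl e1,
        sum_ite_shift_range (fun l => usage y S' (J + s) (l + s) (m + s) * mid (l + s) (m + s)) s (J + s) (by omega),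
        show J + s + 1 - s = J + 1 by omega, Finset.mul_sum]
      refine Finset.sum_le_sum fun l hl => ?_
      rw [Finset.mem_range] at hl
      rcases (hmid0 (l + s) (m + s)).eq_or_lt with hz | hp
      · rw [← hz, mul_zero]
        by_cases hl1 : 1 ≤ l
        · rw [if_pos hl1]; exact mul_nonneg hc0 (hterm l m)
        · rw [if_neg hl1, mul_zero]
      · obtain ⟨⟨ht, _, _⟩, hfp⟩ := hmidpos (l + s) (m + s) hp
        simp only [Nat.add_sub_cancel] at hfp
        have hl1 : 1 ≤ l := by omega
        rw [if_pos hl1]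
        have hmidval : mid (l + s) (m + s) = c * f l m := by
          simp only [hmid]; rw [if_pos ⟨ht, hk1, hkJ⟩, Nat.add_sub_cancel, Nat.add_sub_cancel]
        rw [hmidval]
        obtain ⟨_, hlow, _, hadm⟩ := hsupp l m hfp
        have hus := usage_copy_le y S Δ J s l m hy0 hy1 hs hΔs hlow (hlh l m hfp) hadm
        calc usage y S' (J + s) (l + s) (m + s) * (c * f l m) = c * (usage y S' (J + s) (l + s) (m + s) * f l m) := by ring
          _ ≤ c * (usage y S J l m * f l m) :=
            mul_le_mul_of_nonneg_left (mul_le_mul_of_nonneg_right hus hfp.le) hc0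
    -- the slot part is exactly the zero row's term
    have hT2 : usage y S J 0 m * slot (m + s) = c * (usage y S J 0 m * f 0 m) := by
      simp only [hslot]; rw [if_pos ⟨hk1, hkJ⟩, Nat.add_sub_cancel]; ring
    have hsplitν : c * ∑ l ∈ Finset.range (J + 1), usage y S J l m * f l m
        = c * ∑ l ∈ Finset.range (J + 1), (if 1 ≤ l then usage y S J l m * f l m else 0) + c * (usage y S J 0 m * f 0 m) := by
      have e : ∀ l ∈ Finset.range (J + 1), usage y S J l m * f l m
          = (if 1 ≤ l then usage y S J l m * f l m else 0) + (if l = 0 then usage y S J l m * f l m else 0) := by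
        intro l _
        by_cases hl : 1 ≤ l
        · rw [if_pos hl, if_neg (by omega), add_zero]
        · rw [if_neg hl, if_pos (by omega), zero_add]
      rw [Finset.sum_congr rfl e, Finset.sum_add_distrib, Finset.sum_ite_eq' (Finset.range (J + 1)) 0,
        if_pos (Finset.mem_range.2 (Nat.succ_pos J))]
      ring
    rw [hsplitν, hT2]
    linarith
  have hcolcap : ∀ k, s + 1 ≤ k → k ≤ J + s →
      c * ∑ l ∈ Finset.range (J + 1), usage y S J l (k - s) * f l (k - s) ≤ c * ν (k - s) := by
    intro k hk1 hkJ
    refine mul_le_mul_of_nonneg_left ?_ hc0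
    by_cases hkM : k - s ≤ M₁
    · by_cases habs : J + 1 ≤ k - s ∨ S ≤ 2 * (((k - s : ℕ)) : ℝ)
      · exact hcap (k - s) hkM habs
      · have : ∀ l ∈ Finset.range (J + 1), usage y S J l (k - s) * f l (k - s) = 0 := by
          intro l _
          rcases (hf0 l (k - s)).eq_or_lt with hz | hp
          · rw [← hz, mul_zero]
          · exfalso
            obtain ⟨_, hlow, _, hadm⟩ := hsupp l (k - s) hp
            apply habs
            rcases hadm with h1 | h2
            · exact Or.inl h1
            · right; linarith [(Nat.cast_nonneg l : (0 : ℝ) ≤ l)]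
        rw [Finset.sum_eq_zero this, hνpos (k - s) (by omega)]
        exact mul_nonneg hq0.le (hμ0 _)
    · have : ∀ l ∈ Finset.range (J + 1), usage y S J l (k - s) * f l (k - s) = 0 := by
        intro l _; rw [hfM l (k - s) (by omega), mul_zero]
      rw [Finset.sum_eq_zero this, hνpos (k - s) (by omega)]
      exact mul_nonneg hq0.le (hμ0 _)
  /- ### totals: `Σ R`, the zero-row split, the giant certification -/
  have hQle : ∑ t ∈ Finset.range (J + s + 1), R t
      ≤ c * (q * μ₁ 0) + c * ∑ l ∈ Finset.range J, ∑ h ∈ Finset.Ico (J + 1) (M₁ + 1), f (l + 1) h := by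
    -- reindex `t = i + s` over `i ≤ J`: `i = 0` gives `R s ≤ c q μ₁ 0`, `i = l + 1` gives the giant-bound mass of `l + 1`
    have e1 : ∀ t ∈ Finset.range (J + s + 1), R t = (if s ≤ t then (fun i => R (i + s)) (t - s) else 0) := by
      intro t _
      by_cases hst : s ≤ t
      · rw [if_pos hst]; simp only [Nat.sub_add_cancel hst]
      · rw [if_neg hst, hRz t (fun hc => hst (by omega)) (fun hc => hst (by omega))]
    rw [Finset.sum_congr rfl e1, sum_ite_shift_range (fun i => R (i + s)) s (J + s) (by omega),
      show J + s + 1 - s = J + 1 by omega, Finset.sum_range_succ' (fun i => R (i + s))]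
    simp only [Nat.zero_add]
    have hR1le : R s ≤ c * (q * μ₁ 0) := by
      by_cases hsl : 2 * (s : ℝ) < S'
      · rw [hRs hsl]
      · rw [hRz s (fun hc => absurd hc.1 (by omega)) (fun hc => hsl hc.2)]
        exact mul_nonneg hc0 (mul_nonneg hq0.le (hμ0 0))
    have hRle : ∀ l ∈ Finset.range J, R (l + 1 + s) ≤ c * ∑ h ∈ Finset.Ico (J + 1) (M₁ + 1), f (l + 1) h := by
      intro l hl
      rw [Finset.mem_range] at hl
      by_cases ht : (s + 1 ≤ l + 1 + s ∧ l + 1 + s ≤ J + s ∧ 2 * (((l + 1 + s : ℕ)) : ℝ) < S')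
      · rw [hRnz _ ht, sum_range_ite_ge_eq_Ico]
        simp only [show l + 1 + s - s = l + 1 by omega, le_refl]
      · rw [hRz _ ht (fun hc => absurd hc.1 (by omega))]
        exact mul_nonneg hc0 (Finset.sum_nonneg fun h _ => hf0 _ _)
    have := Finset.sum_le_sum hRle
    rw [← Finset.mul_sum] at this
    linarith
  have hzsplit : ∑ k ∈ Finset.range (M + 1), slot k = c * ν 0 - c * ∑ h ∈ Finset.Ico (J + 1) (M₁ + 1), f 0 h := by
    have e1 : ∀ k ∈ Finset.range (M + 1), slot k
        = (if s ≤ k then (fun i => if 1 ≤ i ∧ i ≤ J then c * f 0 i else 0) (k - s) else 0) := by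
      intro k _
      simp only [hslot]
      by_cases hsk : s ≤ k
      · rw [if_pos hsk]
        by_cases hi : 1 ≤ k - s ∧ k - s ≤ J
        · rw [if_pos hi, if_pos ⟨by omega, by omega⟩]
        · rw [if_neg hi, if_neg (fun hc => hi ⟨by omega, by omega⟩)]
      · rw [if_neg hsk, if_neg (fun hc => hsk (by omega))]
    rw [Finset.sum_congr rfl e1, sum_ite_shift_range (fun i => if 1 ≤ i ∧ i ≤ J then c * f 0 i else 0) s M (by omega)]
    -- `Σ_{i} [1 ≤ i ≤ J] f 0 i = ν 0 − Σ_{J < h ≤ M₁} f 0 h`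
    have hzG : ∑ h ∈ Finset.Ico (J + 1) (M₁ + 1), f 0 h
        = ν 0 - ∑ h ∈ Finset.range (M₁ + 1), (if 1 ≤ h ∧ h ≤ J then f 0 h else 0) := by
      rw [← sum_range_ite_ge_eq_Ico, ← hrow0, ← Finset.sum_sub_distrib]
      refine Finset.sum_congr rfl fun h _ => ?_
      by_cases hh : J + 1 ≤ h
      · rw [if_pos hh, if_neg (by omega), sub_zero]
      · by_cases h1 : 1 ≤ h
        · rw [if_neg hh, if_pos ⟨h1, by omega⟩, sub_self]
        · have h0 : h = 0 := by omega
          subst h0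
          rw [if_neg hh, if_neg (fun hc => absurd hc.1 (by omega))]
          rcases (hf0 0 0).eq_or_lt with hz | hp
          · rw [← hz, sub_zero]
          · exact absurd (hlh 0 0 hp) (lt_irrefl 0)
    have e2 : ∑ i ∈ Finset.range (M + 1 - s), (if 1 ≤ i ∧ i ≤ J then c * f 0 i else 0)
        = c * ∑ h ∈ Finset.range (M₁ + 1), (if 1 ≤ h ∧ h ≤ J then f 0 h else 0) := by
      rw [Finset.mul_sum]
      have hsub : ∑ h ∈ Finset.range (M₁ + 1), c * (if 1 ≤ h ∧ h ≤ J then f 0 h else 0)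
          = ∑ h ∈ Finset.range (M + 1 - s), c * (if 1 ≤ h ∧ h ≤ J then f 0 h else 0) :=
        Finset.sum_subset (Finset.range_mono (show M₁ + 1 ≤ M + 1 - s by omega)) (fun h hh hn => by
          rw [Finset.mem_range] at hh hn
          rw [hfM 0 h (by omega)]; simp)
      rw [hsub]
      exact Finset.sum_congr rfl fun i _ => by split_ifs <;> ring
    rw [e2, hzG]; ring
  have hgiants : uy * (c * ∑ l ∈ Finset.range (J + 1), ∑ h ∈ Finset.Ico (J + 1) (M₁ + 1), f l h)
      ≤ c * ∑ h ∈ Finset.Ico (J + 1) (M₁ + 1), ν h := by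
    have hper : ∀ h ∈ Finset.Ico (J + 1) (M₁ + 1), uy * ∑ l ∈ Finset.range (J + 1), f l h ≤ ν h := by
      intro h hh
      rw [Finset.mem_Ico] at hh
      have hch := hcap h (by omega) (Or.inl hh.1)
      have e : ∑ l ∈ Finset.range (J + 1), usage y S J l h * f l h = uy * ∑ l ∈ Finset.range (J + 1), f l h := by
        rw [Finset.mul_sum]
        exact Finset.sum_congr rfl fun l _ => by rw [usage_giant_eq y S J l h hh.1]
      rw [e] at hch
      exact hch
    have hsum := Finset.sum_le_sum hper
    rw [← Finset.mul_sum, Finset.sum_comm] at hsum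
    calc uy * (c * ∑ l ∈ Finset.range (J + 1), ∑ h ∈ Finset.Ico (J + 1) (M₁ + 1), f l h)
        = c * (uy * ∑ l ∈ Finset.range (J + 1), ∑ h ∈ Finset.Ico (J + 1) (M₁ + 1), f l h) := by ring
      _ ≤ c * ∑ h ∈ Finset.Ico (J + 1) (M₁ + 1), ν h := mul_le_mul_of_nonneg_left hsum hc0
  have hkey : uy * (c * (1 - q) + ∑ t ∈ Finset.range (J + s + 1), R t - ∑ k ∈ Finset.range (M + 1), slot k)
      ≤ c * ∑ h ∈ Finset.Ico (J + 1) (M₁ + 1), ν h := by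
    have hsplit : ∑ l ∈ Finset.range (J + 1), ∑ h ∈ Finset.Ico (J + 1) (M₁ + 1), f l h
        = ∑ l ∈ Finset.range J, ∑ h ∈ Finset.Ico (J + 1) (M₁ + 1), f (l + 1) h + ∑ h ∈ Finset.Ico (J + 1) (M₁ + 1), f 0 h := by
      rw [Finset.sum_range_succ']
    have hle : c * (1 - q) + ∑ t ∈ Finset.range (J + s + 1), R t - ∑ k ∈ Finset.range (M + 1), slot k
        ≤ c * ∑ l ∈ Finset.range (J + 1), ∑ h ∈ Finset.Ico (J + 1) (M₁ + 1), f l h := by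
      rw [hsplit, hzsplit, hν0, mul_add]
      linarith [hQle]
    exact le_trans (mul_le_mul_of_nonneg_left hle huy0.le) hgiants
  exact ⟨mid, slot, R, hmid0, hslot0, hR0, hmidsupp, hmidz, hslotsupp, hslotz, hcol, hcolcap, hrowid, ⟨hRs, hRz⟩, hQle,
    hzsplit, hgiants, hkey⟩


end LawDec

end Quant

end Summit.CriticalPhenomena.PercolationContinuityZ3.Theorems
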